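import Summits.Ventures.Crystal3D.Theorems.StickyWulffConstantNoReconstructionGainFccShell
import HarnessLib

/-!
# The cubic frame of the model fcc lattice: coordinates, rounding, short vectors

HONEST FRAMING. Part of the venture `Summits/Ventures/Crystal3D` (cell `crystal3d-full`), helper
`--supports` the crux `NoReconstructionGain` (stmt-Ventures-19144, route
`route-Ventures-StickyWulffConstant`), line `adhesion`.  Infrastructure for the R26 support lemma
L3′ («a point off `Λ₀ = fccStacking 1 √(2/3)` is at unit distance from at most three sites of
`Λ₀`», file `…NoReconstructionGainOffLattice`).  Nothing about packings.

The CUBIC COORDINATES of `p ∈ ℝ³` are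
`A(p) = p₀ + (√3/3) p₁ − √(2/3) p₂`, `B(p) = p₀ − (√3/3) p₁ + √(2/3) p₂`, `C(p) = (2√3/3) p₁ + √(2/3) p₂`
(inner products with the pairwise orthogonal vectors `u+v−t`, `u−v+t`, `−u+v+t` of norm `√2`, where
`u, v, t` are the sites `(0,1,0), (0,0,1), (1,0,0)` of `Λ₀`).  In these coordinates `Λ₀` is the
checkerboard lattice `D₃ = {(a,b,c) ∈ ℤ³ : a + b + c even}` with nearest-neighbour distance `√2`:

* `cubic_barlowPos` — the site `(k,i,j)` has cubic coordinates `(i+j, i+k, j+k)`;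
* `two_mul_norm_sq_eq_cubic` — `2‖p‖² = A² + B² + C²`;
* `barlowPos_of_cubic` — every even-sum integer triple is the cubic coordinate vector of a site;
* `exists_even_round` — every real triple is within distance `1` of an even-sum integer triple
  (round each coordinate; if the parity is wrong, re-round the worst coordinate the other way);
* `exists_fcc_dist_sq_le_half` — hence every point of `ℝ³` is within `1/√2` of `Λ₀` (the covering
  radius: the octahedral hole);
* `short_even_vectors` — the even-sum integer triples of norm² `< 6` are `0`, the twelve
  `(±1,±1,0)`-type and the six `(±2,0,0)`-type vectors (explicit lists).

WHAT THIS IS NOT: anything about contact numbers; rung F-C1 not moved.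
-/

noncomputable section

namespace Summit.Ventures.Crystal3D.Theorems

open Summit.Ventures.Crystal3D Finset
open Literature.MathematicalPhysics.StatisticalMechanics (barlowPos barlowStacking fccStacking
  constHagg haggLabel_const barlowPos_mem barlowPos_apply_zero barlowPos_apply_one
  barlowPos_apply_two)

/-- `(√3)² = 3`, `(√(2/3))² = 2/3`. -/
theorem sqrt_three_sq_and : Real.sqrt 3 ^ 2 = 3 ∧ Real.sqrt (2 / 3) ^ 2 = 2 / 3 :=
  ⟨Real.sq_sqrt (by norm_num), Real.sq_sqrt (by norm_num)⟩

/-- **Cubic coordinates of the sites.**  The site `(k, i, j)` of `Λ₀` has cubic coordinates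
`(i + j, i + k, j + k)`. -/
theorem cubic_barlowPos (k i j : ℤ) :
    (barlowPos 1 (Real.sqrt (2 / 3)) constHagg k i j 0 +
        Real.sqrt 3 / 3 * barlowPos 1 (Real.sqrt (2 / 3)) constHagg k i j 1 -
        Real.sqrt (2 / 3) * barlowPos 1 (Real.sqrt (2 / 3)) constHagg k i j 2 = i + j) ∧
    (barlowPos 1 (Real.sqrt (2 / 3)) constHagg k i j 0 -
        Real.sqrt 3 / 3 * barlowPos 1 (Real.sqrt (2 / 3)) constHagg k i j 1 +
        Real.sqrt (2 / 3) * barlowPos 1 (Real.sqrt (2 / 3)) constHagg k i j 2 = i + k) ∧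
    (2 * Real.sqrt 3 / 3 * barlowPos 1 (Real.sqrt (2 / 3)) constHagg k i j 1 +
        Real.sqrt (2 / 3) * barlowPos 1 (Real.sqrt (2 / 3)) constHagg k i j 2 = j + k) := by
  obtain ⟨h3, h23⟩ := sqrt_three_sq_and
  simp only [barlowPos_apply_zero, barlowPos_apply_one, barlowPos_apply_two, haggLabel_const,
    one_mul]
  refine ⟨?_, ?_, ?_⟩
  · linear_combination ((j : ℝ) / 6 + (k : ℝ) / 18) * h3 - (k : ℝ) * h23
  · linear_combination (-(j : ℝ) / 6 - (k : ℝ) / 18) * h3 + (k : ℝ) * h23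
  · linear_combination ((j : ℝ) / 3 + (k : ℝ) / 9) * h3 + (k : ℝ) * h23

/-- **The cubic frame is orthogonal with scale `√2`:** `2‖p‖² = A(p)² + B(p)² + C(p)²`. -/
theorem two_mul_norm_sq_eq_cubic (p : EuclideanSpace ℝ (Fin 3)) :
    2 * ‖p‖ ^ 2 =
      (p 0 + Real.sqrt 3 / 3 * p 1 - Real.sqrt (2 / 3) * p 2) ^ 2 +
        (p 0 - Real.sqrt 3 / 3 * p 1 + Real.sqrt (2 / 3) * p 2) ^ 2 +
        (2 * Real.sqrt 3 / 3 * p 1 + Real.sqrt (2 / 3) * p 2) ^ 2 := by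
  obtain ⟨h3, h23⟩ := sqrt_three_sq_and
  rw [EuclideanSpace.real_norm_sq_eq, Fin.sum_univ_three]
  linear_combination (-(2 : ℝ) / 3 * p 1 ^ 2) * h3 - 3 * p 2 ^ 2 * h23

/-- **Every even-sum integer triple is the cubic coordinate vector of a site** (namely of
`(k, i, j) = ((−a+b+c)/2, (a+b−c)/2, (a−b+c)/2)`). -/
theorem barlowPos_of_cubic (a b c : ℤ) (h : Even (a + b + c)) :
    ∃ k i j : ℤ, i + j = a ∧ i + k = b ∧ j + k = c := by
  obtain ⟨m, hm⟩ := h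
  exact ⟨m - a, m - c, m - b, by omega, by omega, by omega⟩

/-- **Rounding to the checkerboard lattice.**  Every real triple is within Euclidean distance `1`
of an integer triple with even coordinate sum. -/
theorem exists_even_round (x y z : ℝ) :
    ∃ a b c : ℤ, Even (a + b + c) ∧ (x - a) ^ 2 + (y - b) ^ 2 + (z - c) ^ 2 ≤ 1 := by
  -- nearest integers
  have hx := abs_sub_round x
  have hy := abs_sub_round y
  have hz := abs_sub_round z
  set a := round x
  set b := round y
  set c := round z
  rw [abs_le] at hx hy hz
  by_cases hpar : Even (a + b + c)
  · exact ⟨a, b, c, hpar, by nlinarith⟩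
  · -- wrong parity: re-round the coordinate with the largest error to its other neighbour
    have hodd : ∀ a' : ℤ, (a' = a + 1 ∨ a' = a - 1) → Even (a' + b + c) := by
      intro a' ha'
      rcases Int.even_or_odd (a + b + c) with h | h
      · exact absurd h hpar
      · obtain ⟨m, hm⟩ := h
        rcases ha' with rfl | rfl
        · exact ⟨m + 1, by omega⟩
        · exact ⟨m, by omega⟩
    -- the other neighbour of `t` near the integer `n`: `n + 1` if `t ≥ n`, else `n − 1`;
    -- its distance to `t` is `1 − |t − n|`.
    have other : ∀ (t : ℝ) (n : ℤ), -(1 / 2) ≤ t - n → t - n ≤ 1 / 2 →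
        ∃ n' : ℤ, (n' = n + 1 ∨ n' = n - 1) ∧ (t - n') ^ 2 = (1 - |t - n|) ^ 2 := by
      intro t n h1 h2
      rcases le_or_gt 0 (t - n) with h | h
      · refine ⟨n + 1, Or.inl rfl, ?_⟩
        rw [abs_of_nonneg h]; push_cast; ring
      · refine ⟨n - 1, Or.inr rfl, ?_⟩
        rw [abs_of_neg h]; push_cast; ring
    -- case analysis on which error is largest
    have key : ∀ (p q r : ℝ), |q| ≤ |p| → |r| ≤ |p| → |p| ≤ 1 / 2 →
        (1 - |p|) ^ 2 + q ^ 2 + r ^ 2 ≤ 1 := by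
      intro p q r hq hr hp
      have hq2 : q ^ 2 ≤ |p| ^ 2 := by
        rw [← sq_abs q]; exact pow_le_pow_left₀ (abs_nonneg q) hq 2
      have hr2 : r ^ 2 ≤ |p| ^ 2 := by
        rw [← sq_abs r]; exact pow_le_pow_left₀ (abs_nonneg r) hr 2
      nlinarith [abs_nonneg p]
    rcases le_total |y - b| |x - a| with hyx | hxy
    · rcases le_total |z - c| |x - a| with hzx | hxz
      · -- x has the largest error
        obtain ⟨a', ha', hd⟩ := other x a hx.1 hx.2
        refine ⟨a', b, c, hodd a' ha', ?_⟩
        rw [hd]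
        have := key (x - a) (y - b) (z - c) hyx hzx (abs_le.2 hx)
        linarith
      · -- z has the largest error
        obtain ⟨c', hc', hd⟩ := other z c hz.1 hz.2
        refine ⟨a, b, c', ?_, ?_⟩
        · have h' := hodd (a + (c' - c)) (by rcases hc' with h | h <;> [left; right] <;> omega)
          have : a + (c' - c) + b + c = a + b + c' := by ring
          rwa [this] at h'
        · rw [hd]
          have := key (z - c) (x - a) (y - b) hxz (hyx.trans hxz) (abs_le.2 hz)
          linarith
    · rcases le_total |z - c| |y - b| with hzy | hyz
      · -- y has the largest error
        obtain ⟨b', hb', hd⟩ := other y b hy.1 hy.2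
        refine ⟨a, b', c, ?_, ?_⟩
        · have h' := hodd (a + (b' - b)) (by rcases hb' with h | h <;> [left; right] <;> omega)
          have : a + (b' - b) + b + c = a + b' + c := by ring
          rwa [this] at h'
        · rw [hd]
          have := key (y - b) (x - a) (z - c) hxy hzy (abs_le.2 hy)
          linarith
      · -- z has the largest error
        obtain ⟨c', hc', hd⟩ := other z c hz.1 hz.2
        refine ⟨a, b, c', ?_, ?_⟩
        · have h' := hodd (a + (c' - c)) (by rcases hc' with h | h <;> [left; right] <;> omega)
          have : a + (c' - c) + b + c = a + b + c' := by ring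
          rwa [this] at h'
        · rw [hd]
          have := key (z - c) (x - a) (y - b) (hxy.trans hyz) hyz (abs_le.2 hz)
          linarith

/-- **Covering radius of `Λ₀`.**  Every point of `ℝ³` is within distance `1/√2` (squared distance
`1/2`) of a site of `Λ₀ = fccStacking 1 √(2/3)`. -/
theorem exists_fcc_dist_sq_le_half (q : EuclideanSpace ℝ (Fin 3)) :
    ∃ z ∈ fccStacking 1 (Real.sqrt (2 / 3)), ‖q - z‖ ^ 2 ≤ 1 / 2 := by
  obtain ⟨a, b, c, habc, hd⟩ := exists_even_round
    (q 0 + Real.sqrt 3 / 3 * q 1 - Real.sqrt (2 / 3) * q 2)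
    (q 0 - Real.sqrt 3 / 3 * q 1 + Real.sqrt (2 / 3) * q 2)
    (2 * Real.sqrt 3 / 3 * q 1 + Real.sqrt (2 / 3) * q 2)
  obtain ⟨k, i, j, hij, hik, hjk⟩ := barlowPos_of_cubic a b c habc
  refine ⟨barlowPos 1 (Real.sqrt (2 / 3)) constHagg k i j, barlowPos_mem _ _ _, ?_⟩
  obtain ⟨hA, hB, hC⟩ := cubic_barlowPos k i j
  have h2 := two_mul_norm_sq_eq_cubic (q - barlowPos 1 (Real.sqrt (2 / 3)) constHagg k i j)
  simp only [PiLp.sub_apply] at h2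
  have ha : (a : ℝ) = i + j := by exact_mod_cast hij.symm
  have hb : (b : ℝ) = i + k := by exact_mod_cast hik.symm
  have hc : (c : ℝ) = j + k := by exact_mod_cast hjk.symm
  rw [ha, ← hA, hb, ← hB, hc, ← hC] at hd
  nlinarith [hd, h2]

/-- The twelve first neighbours `(±1,±1,0)`-type and the six second neighbours `(±2,0,0)`-type of
the checkerboard lattice `D₃`: **every even-sum integer triple of norm² `< 6` is `0` or one of
them.** -/
theorem short_even_vectors (a b c : ℤ) (h : Even (a + b + c)) (hn : a ^ 2 + b ^ 2 + c ^ 2 < 6) :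
    (a, b, c) = (0, 0, 0) ∨
    (a, b, c) ∈ [((1 : ℤ), (1 : ℤ), (0 : ℤ)), (1, -1, 0), (-1, 1, 0), (-1, -1, 0),
      (1, 0, 1), (1, 0, -1), (-1, 0, 1), (-1, 0, -1),
      (0, 1, 1), (0, 1, -1), (0, -1, 1), (0, -1, -1)] ∨
    (a, b, c) ∈ [((2 : ℤ), (0 : ℤ), (0 : ℤ)), (-2, 0, 0), (0, 2, 0), (0, -2, 0), (0, 0, 2),
      (0, 0, -2)] := by
  have ha' : -2 ≤ a ∧ a ≤ 2 := by constructor <;> nlinarith [sq_nonneg b, sq_nonneg c]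
  have hb' : -2 ≤ b ∧ b ≤ 2 := by constructor <;> nlinarith [sq_nonneg a, sq_nonneg c]
  have hc' : -2 ≤ c ∧ c ≤ 2 := by constructor <;> nlinarith [sq_nonneg a, sq_nonneg b]
  have hmod : (a + b + c) % 2 = 0 := by obtain ⟨m, hm⟩ := h; omega
  -- a bounded, decidable statement
  have key : ∀ a₁ ∈ Finset.Icc (-2 : ℤ) 2, ∀ b₁ ∈ Finset.Icc (-2 : ℤ) 2, ∀ c₁ ∈ Finset.Icc (-2 : ℤ) 2,
      (a₁ + b₁ + c₁) % 2 = 0 → a₁ ^ 2 + b₁ ^ 2 + c₁ ^ 2 < 6 →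
      ((a₁, b₁, c₁) = ((0 : ℤ), (0 : ℤ), (0 : ℤ)) ∨
      (a₁, b₁, c₁) ∈ [((1 : ℤ), (1 : ℤ), (0 : ℤ)), (1, -1, 0), (-1, 1, 0), (-1, -1, 0),
        (1, 0, 1), (1, 0, -1), (-1, 0, 1), (-1, 0, -1),
        (0, 1, 1), (0, 1, -1), (0, -1, 1), (0, -1, -1)] ∨
      (a₁, b₁, c₁) ∈ [((2 : ℤ), (0 : ℤ), (0 : ℤ)), (-2, 0, 0), (0, 2, 0), (0, -2, 0), (0, 0, 2),
        (0, 0, -2)]) := by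
    decide
  exact key a (Finset.mem_Icc.2 ha') b (Finset.mem_Icc.2 hb') c (Finset.mem_Icc.2 hc') hmod hn

end Summit.Ventures.Crystal3D.Theorems
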